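import Literature.NumberTheory.Transcendental.MasserLemma24Prelim
import HarnessLib

/-!
# Masser 1975, Lemma 2.4 (the Main Lemma) — the points `z(r₀, r₁, r₂)`

Support for the book's own proof (Ch. II) of
`Literature.NumberTheory.Transcendental.masser_ellipticPeriods` (Masser 1975, Theorem II);
continuation of `MasserLemma24Prelim.lean`.

Given two integer triples `(A, B, C)`, `(D, E, F)` with period forms `δ ≠ 0`, `ε`, and `N ≥ 1`
(Masser's `L`), we define Masser's points
`z(r₀,r₁,r₂) = ¼ + θr₁/(ω₁ω₂N⁷) + (mC + r₀F)τ`, `θ = δ/|δ|`, `m = m(r₁,r₂)` the nearest integer to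
`(r₂ - r₁)/(|δ|N⁷)` (Masser 1975, p. 19), and prove: they lie in `ξ` (eqs. (21), (22)), the values
of `℘(ω₁z)`, `℘(ω₂z)` there ((23)) and of `f` there ((24)–(26)), with explicit error terms in
`|δ|`, `|ε|`, `N`. The asymptotic bookkeeping and the two applications of Lemma 2.3 are the sequel.

Everything here is proved; no named facts.

## References

* D. W. Masser, *Elliptic Functions and Transcendence*, Lecture Notes in Math. 437, Springer 1975,
  Ch. II §2.3, proof of Lemma 2.4 (pp. 19–21). [Masser1975]
-/

noncomputable section

open Complex Metric Set Real Filter Finset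
open scoped PeriodPair

namespace Literature.NumberTheory.Transcendental.Masser1975

/-- The data of the construction: the disc, `N`, and the two triples. [cite: Masser1975, §2.3 (p. 19)] -/
structure PtData (L : PeriodPair) where
  /-- Lemma 1.1 -/
  d : DiscData L
  /-- Masser's `L` -/
  N : ℕ
  /-- the first triple (`δ`) -/
  A : ℤ
  /-- the first triple (`δ`) -/
  B : ℤ
  /-- the first triple (`δ`) -/
  C : ℤ
  /-- the second triple (`ε`) -/
  D : ℤ
  /-- the second triple (`ε`) -/
  E : ℤ
  /-- the second triple (`ε`) -/
  F : ℤ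
  hN : 1 ≤ N
  hδ : periodForm L (A, B, C) ≠ 0

namespace PtData

variable {L : PeriodPair} (T : PtData L)

/-- `δ = Aω₁² + Bω₁ω₂ + Cω₂²`. [cite: Masser1975, §2.3] -/
def δ : ℂ := periodForm L (T.A, T.B, T.C)
/-- `ε = Dω₁² + Eω₁ω₂ + Fω₂²`. [cite: Masser1975, §2.3] -/
def ε : ℂ := periodForm L (T.D, T.E, T.F)
/-- `θ = δ/|δ|`. [cite: Masser1975, §2.3] -/
def θ : ℂ := T.δ / (‖T.δ‖ : ℂ)
/-- `z(r) = ¼ + θ r/(ω₁ω₂N⁷)`. [cite: Masser1975, §2.3 (z(r))] -/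
def wpt (r : ℤ) : ℂ := 1 / 4 + T.θ * r / (L.ω₁ * L.ω₂ * (T.N : ℂ) ^ 7)
/-- `m(r₁, r₂)` = the integer nearest to `(r₂ - r₁)/(|δ| N⁷)`. [cite: Masser1975, §2.3] -/
def mOf (r₁ r₂ : ℤ) : ℤ := round (((r₂ - r₁ : ℤ) : ℝ) / (‖T.δ‖ * (T.N : ℝ) ^ 7))
/-- `M = mC + r₀F`. [cite: Masser1975, §2.3] -/
def Mint (r₀ r₁ r₂ : ℤ) : ℤ := T.mOf r₁ r₂ * T.C + r₀ * T.F
/-- **Masser's points** `z(r₀,r₁,r₂) = z(r₁) + (mC + r₀F)τ`. [cite: Masser1975, §2.3 (z(r₀,r₁,r₂))] -/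
def Zpt (r₀ r₁ r₂ : ℤ) : ℂ := T.wpt r₁ + (T.Mint r₀ r₁ r₂ : ℂ) * (L.ω₂ / L.ω₁)
/-- The shift `s = (mδ + r₀ε)/(ω₁ω₂)`. [cite: Masser1975, §2.3 (z')] -/
def shift (r₀ r₁ r₂ : ℤ) : ℂ := ((T.mOf r₁ r₂ : ℂ) * T.δ + (r₀ : ℂ) * T.ε) / (L.ω₁ * L.ω₂)
/-- `z' = z(r₁) + (mδ + r₀ε)/(ω₁ω₂)`. [cite: Masser1975, §2.3 (z')] -/
def w'pt (r₀ r₁ r₂ : ℤ) : ℂ := T.wpt r₁ + T.shift r₀ r₁ r₂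

/-! ### Elementary facts -/

/-- `ω₁ ≠ 0`. [folklore] -/
theorem ω₁_ne : L.ω₁ ≠ 0 := by simpa using basis_ne_zero L 0

/-- `ω₂ ≠ 0`. [folklore] -/
theorem ω₂_ne : L.ω₂ ≠ 0 := by simpa using basis_ne_zero L 1

/-- `‖θ‖ = 1`. [folklore] -/
theorem norm_θ : ‖T.θ‖ = 1 := by
  unfold θ
  have h0 : ‖T.δ‖ ≠ 0 := norm_ne_zero_iff.mpr T.hδ
  rw [norm_div, Complex.norm_real, Real.norm_eq_abs, abs_of_nonneg (norm_nonneg _), div_self h0]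

/-- `δ = |δ| θ`. [folklore] -/
theorem δ_eq : T.δ = (‖T.δ‖ : ℂ) * T.θ := by
  unfold θ
  have h0 : (‖T.δ‖ : ℂ) ≠ 0 := by exact_mod_cast norm_ne_zero_iff.mpr T.hδ
  field_simp

/-- `0 < N` as a real. [folklore] -/
theorem N_pos : (0 : ℝ) < T.N := by exact_mod_cast T.hN

/-- `‖z(r) - ¼‖ = |r|/(|ω₁ω₂| N⁷)`. [folklore] -/
theorem norm_wpt_sub (r : ℤ) : ‖T.wpt r - 1 / 4‖ = |(r : ℝ)| / (‖L.ω₁ * L.ω₂‖ * (T.N : ℝ) ^ 7) := by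
  unfold wpt
  rw [add_sub_cancel_left, norm_div, norm_mul, norm_mul, norm_θ, one_mul, Complex.norm_intCast, norm_pow]
  norm_cast

/-- `‖z(r) - ¼‖ ≤ N⁻⁴/|ω₁ω₂|` for `|r| ≤ N³`. [cite: Masser1975, §2.3] -/
theorem norm_wpt_sub_le {r : ℤ} (hr : |r| ≤ (T.N : ℤ) ^ 3) :
    ‖T.wpt r - 1 / 4‖ ≤ ((T.N : ℝ) ^ 4)⁻¹ / ‖L.ω₁ * L.ω₂‖ := by
  rw [norm_wpt_sub]
  have hω : 0 < ‖L.ω₁ * L.ω₂‖ := norm_pos_iff.mpr (mul_ne_zero ω₁_ne ω₂_ne)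
  have hN := T.N_pos
  have hr' : |(r : ℝ)| ≤ (T.N : ℝ) ^ 3 := by exact_mod_cast hr
  rw [div_le_div_iff₀ (by positivity) hω]
  calc |(r : ℝ)| * ‖L.ω₁ * L.ω₂‖ ≤ (T.N : ℝ) ^ 3 * ‖L.ω₁ * L.ω₂‖ := mul_le_mul_of_nonneg_right hr' hω.le
    _ = ((T.N : ℝ) ^ 4)⁻¹ * (‖L.ω₁ * L.ω₂‖ * (T.N : ℝ) ^ 7) := by field_simp

/-- `|m - (r₂ - r₁)/(|δ|N⁷)| ≤ ½`. [folklore] -/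
theorem abs_mOf_sub_le (r₁ r₂ : ℤ) :
    |(((r₂ - r₁ : ℤ) : ℝ) / (‖T.δ‖ * (T.N : ℝ) ^ 7)) - T.mOf r₁ r₂| ≤ 1 / 2 := by
  unfold mOf
  exact abs_sub_round _

/-- `|m| ≤ 2N³/(|δ|N⁷) + 1` for `|r₁|, |r₂| ≤ N³`. [cite: Masser1975, §2.3 ("|m| < exp((log L)^5)")] -/
theorem abs_mOf_le {r₁ r₂ : ℤ} (h1 : |r₁| ≤ (T.N : ℤ) ^ 3) (h2 : |r₂| ≤ (T.N : ℤ) ^ 3) :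
    |(T.mOf r₁ r₂ : ℝ)| ≤ 2 * (T.N : ℝ) ^ 3 / (‖T.δ‖ * (T.N : ℝ) ^ 7) + 1 := by
  have h := T.abs_mOf_sub_le r₁ r₂
  have hδ0 : 0 < ‖T.δ‖ := norm_pos_iff.mpr T.hδ
  have hN := T.N_pos
  have hx : |(((r₂ - r₁ : ℤ) : ℝ) / (‖T.δ‖ * (T.N : ℝ) ^ 7))| ≤ 2 * (T.N : ℝ) ^ 3 / (‖T.δ‖ * (T.N : ℝ) ^ 7) := by
    rw [abs_div, abs_of_pos (by positivity : 0 < ‖T.δ‖ * (T.N : ℝ) ^ 7)]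
    refine div_le_div_of_nonneg_right ?_ (by positivity)
    have h1' : |(r₁ : ℝ)| ≤ (T.N : ℝ) ^ 3 := by exact_mod_cast h1
    have h2' : |(r₂ : ℝ)| ≤ (T.N : ℝ) ^ 3 := by exact_mod_cast h2
    push_cast
    calc |(r₂ : ℝ) - r₁| ≤ |(r₂ : ℝ)| + |(r₁ : ℝ)| := abs_sub _ _
      _ ≤ 2 * (T.N : ℝ) ^ 3 := by linarith
  have := abs_sub_abs_le_abs_sub (T.mOf r₁ r₂ : ℝ) (((r₂ - r₁ : ℤ) : ℝ) / (‖T.δ‖ * (T.N : ℝ) ^ 7))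
  rw [abs_sub_comm] at h
  linarith

/-- **The key smallness**: `‖θ(r₁ - r₂)/N⁷ + mδ‖ ≤ |δ|/2` (definition of `m`). [cite: Masser1975, §2.3 ("from the definition of m …")] -/
theorem norm_θ_mul_add_le (r₁ r₂ : ℤ) :
    ‖T.θ * ((r₁ - r₂ : ℤ) : ℂ) / (T.N : ℂ) ^ 7 + (T.mOf r₁ r₂ : ℂ) * T.δ‖ ≤ ‖T.δ‖ / 2 := by
  have hδ0 : 0 < ‖T.δ‖ := norm_pos_iff.mpr T.hδ
  have hN0 : (T.N : ℂ) ≠ 0 := by exact_mod_cast (Nat.pos_iff_ne_zero.mp T.hN)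
  have hδc : (‖T.δ‖ : ℂ) ≠ 0 := by exact_mod_cast hδ0.ne'
  set x : ℝ := (((r₂ - r₁ : ℤ) : ℝ) / (‖T.δ‖ * (T.N : ℝ) ^ 7)) with hx
  -- `θ(r₁-r₂)/N⁷ + m|δ|θ = θ|δ| (m - x)`
  have key : T.θ * ((r₁ - r₂ : ℤ) : ℂ) / (T.N : ℂ) ^ 7 + (T.mOf r₁ r₂ : ℂ) * T.δ =
      T.θ * (‖T.δ‖ : ℂ) * (((T.mOf r₁ r₂ : ℝ) - x : ℝ) : ℂ) := by
    conv_lhs => rw [T.δ_eq]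
    rw [hx]
    push_cast
    field_simp
    ring
  rw [key, norm_mul, norm_mul, norm_θ, one_mul, Complex.norm_real, Real.norm_eq_abs, abs_of_pos hδ0,
    Complex.norm_real, Real.norm_eq_abs, abs_sub_comm]
  have h := T.abs_mOf_sub_le r₁ r₂
  rw [← hx] at h
  calc ‖T.δ‖ * |x - T.mOf r₁ r₂| ≤ ‖T.δ‖ * (1 / 2) := mul_le_mul_of_nonneg_left h hδ0.le
    _ = ‖T.δ‖ / 2 := by ring

/-- `z' - z(r₂) = (θ(r₁-r₂)/N⁷ + mδ)/(ω₁ω₂) + r₀ε/(ω₁ω₂)`, so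
`‖z' - z(r₂)‖ ≤ (|δ|/2 + |r₀| |ε|)/|ω₁ω₂|`. [cite: Masser1975, §2.3 (proof of (23) for i = 2)] -/
theorem norm_w'pt_sub_wpt_le (r₀ r₁ r₂ : ℤ) :
    ‖T.w'pt r₀ r₁ r₂ - T.wpt r₂‖ ≤ (‖T.δ‖ / 2 + |(r₀ : ℝ)| * ‖T.ε‖) / ‖L.ω₁ * L.ω₂‖ := by
  have hω : L.ω₁ * L.ω₂ ≠ 0 := mul_ne_zero ω₁_ne ω₂_ne
  have hω0 : 0 < ‖L.ω₁ * L.ω₂‖ := norm_pos_iff.mpr hω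
  have hN7 : ((T.N : ℂ)) ^ 7 ≠ 0 := pow_ne_zero _ (by exact_mod_cast (Nat.pos_iff_ne_zero.mp T.hN))
  have key : T.w'pt r₀ r₁ r₂ - T.wpt r₂ =
      (T.θ * ((r₁ - r₂ : ℤ) : ℂ) / (T.N : ℂ) ^ 7 + (T.mOf r₁ r₂ : ℂ) * T.δ) / (L.ω₁ * L.ω₂) +
        (r₀ : ℂ) * T.ε / (L.ω₁ * L.ω₂) := by
    unfold w'pt wpt shift
    push_cast
    field_simp
    ring
  rw [key]
  have e1 : ‖(T.θ * ((r₁ - r₂ : ℤ) : ℂ) / (T.N : ℂ) ^ 7 + (T.mOf r₁ r₂ : ℂ) * T.δ) / (L.ω₁ * L.ω₂)‖ ≤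
      (‖T.δ‖ / 2) / ‖L.ω₁ * L.ω₂‖ := by
    rw [norm_div]; exact div_le_div_of_nonneg_right (T.norm_θ_mul_add_le r₁ r₂) (norm_nonneg _)
  have e2 : ‖(r₀ : ℂ) * T.ε / (L.ω₁ * L.ω₂)‖ = |(r₀ : ℝ)| * ‖T.ε‖ / ‖L.ω₁ * L.ω₂‖ := by
    rw [norm_div, norm_mul, Complex.norm_intCast]
  calc _ ≤ _ := norm_add_le _ _
    _ ≤ (‖T.δ‖ / 2) / ‖L.ω₁ * L.ω₂‖ + |(r₀ : ℝ)| * ‖T.ε‖ / ‖L.ω₁ * L.ω₂‖ := add_le_add e1 e2.le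
    _ = _ := by rw [← add_div]

/-! ### The points lie in `ξ`, and the values of `℘(ωᵢ ·)` there ((21)–(23)) -/

/-- **(21)**: `ω₁ z = ω₁ z(r₁) + Mω₂`, hence `℘(ω₁ z(r₀,r₁,r₂)) = ℘(ω₁ z(r₁))`. [cite: Masser1975, §2.3 eq. (21)] -/
theorem scaledP_zero_Zpt (r₀ r₁ r₂ : ℤ) : scaledP L 0 (T.Zpt r₀ r₁ r₂) = scaledP L 0 (T.wpt r₁) := by
  unfold Zpt
  have hmem : ((T.Mint r₀ r₁ r₂ : ℂ)) * L.ω₂ ∈ L.lattice := by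
    simpa using (L.mul_ω₁_add_mul_ω₂_mem_lattice (α := 0) (β := T.Mint r₀ r₁ r₂)).mpr (by simp)
  have h := scaledP_add_div L 0 (T.wpt r₁) hmem
  simp only [PeriodPair.basis_zero] at h
  rw [show (T.Mint r₀ r₁ r₂ : ℂ) * (L.ω₂ / L.ω₁) = (T.Mint r₀ r₁ r₂ : ℂ) * L.ω₂ / L.ω₁ by ring]
  exact h

/-- **(22) at the level of `z`**: `z(r₀,r₁,r₂) = z' + l/ω₂` with
`l = -(mA + r₀D)ω₁ - (mB + r₀E)ω₂`. [cite: Masser1975, §2.3 eq. (22)] -/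
theorem Zpt_eq_w'pt_add (r₀ r₁ r₂ : ℤ) : T.Zpt r₀ r₁ r₂ = T.w'pt r₀ r₁ r₂ +
    (((-(T.mOf r₁ r₂ * T.A + r₀ * T.D) : ℤ) : ℂ) * L.ω₁ + ((-(T.mOf r₁ r₂ * T.B + r₀ * T.E) : ℤ) : ℂ) * L.ω₂) / L.ω₂ := by
  have hω₂ : L.ω₂ ≠ 0 := ω₂_ne
  have e : L.ω₂ * T.Zpt r₀ r₁ r₂ = L.ω₂ * T.w'pt r₀ r₁ r₂ +
      (((-(T.mOf r₁ r₂ * T.A + r₀ * T.D) : ℤ) : ℂ) * L.ω₁ + ((-(T.mOf r₁ r₂ * T.B + r₀ * T.E) : ℤ) : ℂ) * L.ω₂) := by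
    unfold Zpt Mint w'pt shift δ ε
    exact ω₂_mul_add_int_mul_tau L (T.wpt r₁) T.A T.B T.C T.D T.E T.F (T.mOf r₁ r₂) r₀
  have h1 : T.Zpt r₀ r₁ r₂ = L.ω₂ * T.Zpt r₀ r₁ r₂ / L.ω₂ := by field_simp
  rw [h1, e]
  field_simp

/-- **(22)**: `ω₂ z = ω₂ z' + l` with `l ∈ Λ`, hence `℘(ω₂ z(r₀,r₁,r₂)) = ℘(ω₂ z')`. [cite: Masser1975, §2.3 eq. (22)] -/
theorem scaledP_one_Zpt (r₀ r₁ r₂ : ℤ) : scaledP L 1 (T.Zpt r₀ r₁ r₂) = scaledP L 1 (T.w'pt r₀ r₁ r₂) := by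
  have hl : ((-(T.mOf r₁ r₂ * T.A + r₀ * T.D) : ℤ) : ℂ) * L.ω₁ + ((-(T.mOf r₁ r₂ * T.B + r₀ * T.E) : ℤ) : ℂ) * L.ω₂ ∈
      L.lattice := PeriodPair.mem_lattice.mpr ⟨_, _, rfl⟩
  rw [T.Zpt_eq_w'pt_add r₀ r₁ r₂]
  have h := scaledP_add_div L 1 (T.w'pt r₀ r₁ r₂) hl
  simpa only [PeriodPair.basis_one] using h

/-- **The points lie in `ξ`** when `z(r₁)` and `z'` lie in `𝒟`. [cite: Masser1975, §2.3 ("show that z(r₀,r₁,r₂) lies in ξ")] -/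
theorem Zpt_mem_xiSet (r₀ r₁ r₂ : ℤ) (h1 : T.wpt r₁ ∈ closedBall (1 / 4 : ℂ) T.d.ρ)
    (h2 : T.w'pt r₀ r₁ r₂ ∈ closedBall (1 / 4 : ℂ) T.d.ρ) : T.Zpt r₀ r₁ r₂ ∈ xiSet T.d := by
  intro i
  fin_cases i
  · refine ⟨(T.Mint r₀ r₁ r₂ : ℂ) * L.ω₂, ?_, ?_⟩
    · simpa using (L.mul_ω₁_add_mul_ω₂_mem_lattice (α := 0) (β := T.Mint r₀ r₁ r₂)).mpr (by simp)
    · have e : T.Zpt r₀ r₁ r₂ - (T.Mint r₀ r₁ r₂ : ℂ) * L.ω₂ / L.basis 0 = T.wpt r₁ := by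
        simp only [PeriodPair.basis_zero]
        unfold Zpt; ring
      exact e ▸ h1
  · refine ⟨((-(T.mOf r₁ r₂ * T.A + r₀ * T.D) : ℤ) : ℂ) * L.ω₁ + ((-(T.mOf r₁ r₂ * T.B + r₀ * T.E) : ℤ) : ℂ) * L.ω₂,
      PeriodPair.mem_lattice.mpr ⟨_, _, rfl⟩, ?_⟩
    have e : T.Zpt r₀ r₁ r₂ -
        (((-(T.mOf r₁ r₂ * T.A + r₀ * T.D) : ℤ) : ℂ) * L.ω₁ + ((-(T.mOf r₁ r₂ * T.B + r₀ * T.E) : ℤ) : ℂ) * L.ω₂) /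
          L.basis 1 = T.w'pt r₀ r₁ r₂ := by
      simp only [PeriodPair.basis_one]
      rw [T.Zpt_eq_w'pt_add r₀ r₁ r₂]; ring
    exact e ▸ h2

/-- **(23) for `i = 2`**: `‖℘(ω₂ z(r₀,r₁,r₂)) - ℘(ω₂ z(r₂))‖ ≤ c₂ (|δ|/2 + |r₀||ε|)/|ω₁ω₂|` when
`z', z(r₂) ∈ 𝒟`. [cite: Masser1975, §2.3 eq. (23)] -/
theorem norm_scaledP_one_Zpt_sub_le (r₀ r₁ r₂ : ℤ) (h2 : T.w'pt r₀ r₁ r₂ ∈ closedBall (1 / 4 : ℂ) T.d.ρ)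
    (h3 : T.wpt r₂ ∈ closedBall (1 / 4 : ℂ) T.d.ρ) :
    ‖scaledP L 1 (T.Zpt r₀ r₁ r₂) - scaledP L 1 (T.wpt r₂)‖ ≤
      T.d.c₂ * ((‖T.δ‖ / 2 + |(r₀ : ℝ)| * ‖T.ε‖) / ‖L.ω₁ * L.ω₂‖) := by
  rw [scaledP_one_Zpt]
  refine (T.d.upper 1 _ h2 _ h3).trans ?_
  have hc₂ : 0 ≤ T.d.c₂ := by
    by_contra hneg
    push Not at hneg
    have hu : (1 / 4 : ℂ) + T.d.ρ ∈ closedBall (1 / 4 : ℂ) T.d.ρ := by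
      rw [mem_closedBall_iff_norm, add_sub_cancel_left, Complex.norm_real, Real.norm_eq_abs, abs_of_pos T.d.ρ_pos]
    have h := T.d.upper 0 _ hu (1 / 4) (mem_closedBall_self T.d.ρ_pos.le)
    rw [add_sub_cancel_left, Complex.norm_real, Real.norm_eq_abs, abs_of_pos T.d.ρ_pos] at h
    have : T.d.c₂ * T.d.ρ < 0 := mul_neg_of_neg_of_pos hneg T.d.ρ_pos
    linarith [norm_nonneg (scaledP L 0 (1 / 4 + T.d.ρ) - scaledP L 0 (1 / 4))]
  exact mul_le_mul_of_nonneg_left (T.norm_w'pt_sub_wpt_le r₀ r₁ r₂) hc₂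

end PtData

end Literature.NumberTheory.Transcendental.Masser1975
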